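import Summits.BirchSwinnertonDyer.BirchSwinnertonDyer.Theorems.Rank2ObservatoryRank3TamagawaCensus
import Summits.BirchSwinnertonDyer.BirchSwinnertonDyer.Theorems.Rank2ObservatoryRank3TamX1
import Summits.BirchSwinnertonDyer.BirchSwinnertonDyer.Theorems.Rank2ObservatoryRank3TamX2
import HarnessLib

/-!
# BirchSwinnertonDyer — rank ≥ 2 observatory: the SHARPENED KERNEL TAMAGAWA CENSUS of `rank3Table`
# (stage 2: exact `c_p` at the primes of Kodaira type `IV` / `IV*`)

HONEST FRAMING: per-curve certified theorems and census instruments; no claim on BSD in rank ≥ 2.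

Unit `b2b-bsdr2-cert-2`, gen 10, stage 2.  Stage 1 (`Rank2ObservatoryRank3TamagawaCensus`) certified IN
THE KERNEL, for every one of the 9 487 rows of the rank-3 census, a finite set `rowVals` containing the
Tamagawa product `∏_v c_v` — a singleton on 5 442 rows, a bracket on 4 045 (the local sets at primes of
type `IV`, `IV*`: `{1,3}`; `I₀*`: `{1,2,4}`; `Iₙ*`: `{2,4}`).  This file merges the stage-1 row certificates
with the 1 423 EXACT certificates `TamX` of the chunks `Rank2ObservatoryRank3TamX1/2` (a residue root of
the Step-5 / Step-8 quadratic, Hensel-lifted ⟹ `c_p = 3`; exhaustion ⟹ `c_p = 1`;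
`Rank2ObservatoryTamagawaExactLocal/ExactCert`) by ONE linear merge `mergeX` of the two index-sorted
lists, and proves — NO named fact, NO hypothesis —
* `tamagawa_censusX` / `tamagawaProduct_certifiedX`: for every row `i < 9487` the Tamagawa product lies in
  the SHARPENED set `rowValsX R X` (`{c}` at a prime with an exact certificate, the stage-1 set elsewhere)
  and EQUALS `rowValueX R X` when every sharpened local set is a singleton;
* kernel-counted statistics: all 1 362 supplements are consumed by the merge (`rank3TamRows_supplemented`),
  `6558` rows are now KERNEL-EXACT and `2929` bracketed (`rank3TamRows_exact_count`; stage 1: 5442 / 4045;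
  the remaining brackets are the types `I₀*` and `Iₙ*` only), `27856` of the `31050` local values are exact
  singletons (`rank3TamRows_local_exact_count`; stage 1: 26433), every sharpened set has ≤ 12 elements,
  `∏ c_v = 1` exactly on `458` rows and the largest exact product is `480`.
Engines (two implementations + kernel): the exact values agree with engine 1 (`tam.py`, Tate's algorithm
with Silverman's `c`-rules), engine 2 (PARI `elllocalred`, kit job recorded in the cell) and Cremona's
`allbsd` column `CP` on all 9 487 products.
References: [Silverman1994] J. H. Silverman, *Advanced Topics in the Arithmetic of Elliptic Curves*,
GTM 151 (1994), IV.9.4; [Tate1975] J. Tate, *Algorithm for determining the type of a singular fiber in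
an elliptic pencil*, LNM 476 (1975) §§7–8; [CremonaAlgorithms1997] J. E. Cremona, *Algorithms for
Modular Elliptic Curves*, 2nd ed. (1997) §3.2, Table 1.
-/

set_option linter.dupNamespace false
set_option autoImplicit false

namespace Summit.BirchSwinnertonDyer.BirchSwinnertonDyer.Rank2Observatory.Tam

/-- ALL exact supplements: the concatenation of the 2 chunks. [cite: Silverman1994, IV.9.4] -/
def rank3TamX : List (ℕ × List TamX) := rank3TamX1 ++ rank3TamX2

/-- The LINEAR MERGE of the index-sorted stage-1 row certificates with the index-sorted exact
supplements: `(i, R, X)` with `X = []` when row `i` has no supplement (structural on the first list;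
a supplement whose index is not met in order is dropped — `rank3TamRows_supplemented` shows none is).
[folklore] -/
def mergeX : List (ℕ × List TamC) → List (ℕ × List TamX) → List (ℕ × List TamC × List TamX)
  | [], _ => []
  | (i, R) :: rs, [] => (i, R, []) :: mergeX rs []
  | (i, R) :: rs, (j, X) :: xs =>
      if j = i then (i, R, X) :: mergeX rs xs else (i, R, []) :: mergeX rs ((j, X) :: xs)

/-- What membership in a merge says. [folklore] -/
theorem mem_mergeX : ∀ (cs : List (ℕ × List TamC)) (xs : List (ℕ × List TamX)) {i : ℕ}
    {R : List TamC} {X : List TamX}, (i, R, X) ∈ mergeX cs xs → (i, R) ∈ cs ∧ (X = [] ∨ (i, X) ∈ xs)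
  | [], _, _, _, _, h => by simp [mergeX] at h
  | (i', R') :: rs, [], i, R, X, h => by
    simp only [mergeX, List.mem_cons, Prod.mk.injEq] at h
    rcases h with ⟨rfl, rfl, rfl⟩ | h
    · exact ⟨List.mem_cons_self, .inl rfl⟩
    · exact ⟨List.mem_cons_of_mem _ (mem_mergeX rs [] h).1, (mem_mergeX rs [] h).2⟩
  | (i', R') :: rs, (j, X') :: xs, i, R, X, h => by
    by_cases hj : j = i'
    · simp only [mergeX, hj, ↓reduceIte, List.mem_cons, Prod.mk.injEq] at h
      rcases h with ⟨rfl, rfl, rfl⟩ | h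
      · exact ⟨List.mem_cons_self, .inr (List.mem_cons.mpr (.inl (by rw [hj])))⟩
      · obtain ⟨h1, h2⟩ := mem_mergeX rs xs h
        exact ⟨List.mem_cons_of_mem _ h1, h2.imp id fun h => List.mem_cons_of_mem _ h⟩
    · simp only [mergeX, hj, ↓reduceIte, List.mem_cons, Prod.mk.injEq] at h
      rcases h with ⟨rfl, rfl, rfl⟩ | h
      · exact ⟨List.mem_cons_self, .inl rfl⟩
      · obtain ⟨h1, h2⟩ := mem_mergeX rs ((j, X') :: xs) h
        exact ⟨List.mem_cons_of_mem _ h1, h2⟩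

/-- THE SHARPENED ROW CERTIFICATES: stage-1 certificates merged with the exact supplements.
[cite: Silverman1994, IV.9.4] -/
def rank3TamRows : List (ℕ × List TamC × List TamX) := mergeX rank3TamCerts rank3TamX

/-- COVERAGE (kernel): the merged row indices are exactly `0, …, 9486`. [cite: CremonaAlgorithms1997, Table 1] -/
theorem rank3TamRows_indices : rank3TamRows.map (·.1) = List.range 9487 := by
  decide +kernel

/-- All `1362` supplements (`1423` exact certificates: `1010` of kind `1`, `9` of kind `2`, `402` of kind
`3`, `2` of kind `4`) are consumed by the merge. [cite: Silverman1994, IV.9.4] -/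
theorem rank3TamRows_supplemented :
    rank3TamX.length = 1362 ∧ (rank3TamRows.filter fun x => !x.2.2.isEmpty).length = 1362 ∧
    (rank3TamX.map fun x => x.2.length).sum = 1423 ∧
    ((rank3TamX.flatMap (·.2)).map (·.kind)).count 1 = 1010 ∧
    ((rank3TamX.flatMap (·.2)).map (·.kind)).count 2 = 9 ∧
    ((rank3TamX.flatMap (·.2)).map (·.kind)).count 3 = 402 ∧
    ((rank3TamX.flatMap (·.2)).map (·.kind)).count 4 = 2 := by
  refine ⟨?_, ?_, ?_, ?_, ?_, ?_, ?_⟩ <;> decide +kernel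

/-- Every index `i < 9487` has a merged row. [folklore] -/
theorem exists_listedX {i : ℕ} (hi : i < 9487) : ∃ R X, (i, R, X) ∈ rank3TamRows := by
  have hi' : i ∈ rank3TamRows.map (·.1) := by
    rw [rank3TamRows_indices]; exact List.mem_range.mpr hi
  obtain ⟨⟨j, R, X⟩, hm, hj⟩ := List.mem_map.mp hi'
  dsimp only at hj
  subst hj
  exact ⟨R, X, hm⟩

/-- Every listed supplement checks on its row (the two chunk walks). [cite: Silverman1994, IV.9.4] -/
theorem checkX_of_mem {i : ℕ} {X : List TamX} (hm : (i, X) ∈ rank3TamX) (hi : i < rank3Table.length) :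
    (X.all fun F => F.check (rank3Table[i]'hi).intModel) = true := by
  have key : ∀ {ps : List (ℕ × List TamX)}, tamWalkX rank3Table 0 ps = true → (i, X) ∈ ps →
      (X.all fun F => F.check (rank3Table[i]'hi).intModel) = true := fun h hm' ↦ by
    obtain ⟨-, r, hrc, hc⟩ := entry_of_tamWalkX _ 0 _ h i X hm'
    rw [Nat.sub_zero] at hrc
    obtain ⟨hi', hr⟩ := List.getElem?_eq_some_iff.mp hrc
    rw [← hr] at hc
    exact hc
  rcases List.mem_append.mp hm with hm | hm
  · exact key rank3Table_tamWalkX1 hm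
  · exact key rank3Table_tamWalkX2 hm

/-- **THE SHARPENED TAMAGAWA CENSUS** (NO named fact, NO hypothesis): for every merged `(i, R, X)`, row
`i` exists, and its Tamagawa product `∏_v c_v` lies in the sharpened set `rowValsX R X` and equals
`rowValueX R X` when every sharpened local set is a singleton. [cite: Silverman1994, IV.9.4]
[cite: CremonaAlgorithms1997, Table 1] -/
theorem tamagawa_censusX {i : ℕ} {R : List TamC} {X : List TamX} (hm : (i, R, X) ∈ rank3TamRows) :
    ∃ hi : i < rank3Table.length,
      (rank3Table[i]'hi).curve.tamagawaProduct ∈ TamX.rowValsX (R.map TamC.toLocal) X ∧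
      (TamX.rowExactX (R.map TamC.toLocal) X = true →
        (rank3Table[i]'hi).curve.tamagawaProduct = TamX.rowValueX (R.map TamC.toLocal) X) := by
  obtain ⟨hR, hX⟩ := mem_mergeX _ _ hm
  obtain ⟨hi, hrow, -, -, -, -⟩ := tamagawa_census hR
  have hc : (X.all fun F => F.check (rank3Table[i]'hi).intModel) = true := by
    rcases hX with rfl | hX
    · rfl
    · exact checkX_of_mem hX hi
  have hGM : ((rank3Table[i]'hi).intModel.baseChange ℚ).IsGloballyMinimal := by
    rw [← Rank3Row.curve_eq_baseChange]
    exact Rank3Row.isGloballyMinimal_of_mem (List.getElem_mem hi)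
  have hcx : TamX.rowCheckX (R.map TamC.toLocal) X (rank3Table[i]'hi).intModel = true := by
    simp only [TamX.rowCheckX, Bool.and_eq_true]; exact ⟨hrow, hc⟩
  refine ⟨hi, ?_, fun hx ↦ ?_⟩
  · rw [Rank3Row.curve_eq_baseChange]; exact TamX.tamagawaProduct_memX hcx hGM
  · rw [Rank3Row.curve_eq_baseChange]; exact TamX.tamagawaProduct_eqX hcx hGM hx

/-- **Headline**: EVERY row of the rank-3 census has a merged certificate `(i, R, X)`, and its Tamagawa
product is kernel-certified to lie in `rowValsX R X` — EXACT (`= rowValueX R X`) on the 6558 sharpened-exact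
rows. [cite: Silverman1994, IV.9.4] [cite: CremonaAlgorithms1997, Table 1] -/
theorem tamagawaProduct_certifiedX (i : ℕ) (hi : i < rank3Table.length) :
    ∃ (R : List TamC) (X : List TamX), (i, R, X) ∈ rank3TamRows ∧
      (rank3Table[i]'hi).curve.tamagawaProduct ∈ TamX.rowValsX (R.map TamC.toLocal) X ∧
      (TamX.rowExactX (R.map TamC.toLocal) X = true →
        (rank3Table[i]'hi).curve.tamagawaProduct = TamX.rowValueX (R.map TamC.toLocal) X) := by
  obtain ⟨R, X, hm⟩ := exists_listedX (i := i) (by rw [rank3Table_length] at hi; exact hi)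
  obtain ⟨_, hmem, hex⟩ := tamagawa_censusX hm
  exact ⟨R, X, hm, hmem, hex⟩

/-! ### Kernel-counted statistics of the sharpened census -/

set_option maxHeartbeats 2000000 in
/-- `6558` rows are KERNEL-EXACT after sharpening, `2929` still bracketed (types `I₀*`, `Iₙ*`); stage 1:
`5442` / `4045`. [cite: Silverman1994, IV.9.4] -/
theorem rank3TamRows_exact_count :
    (rank3TamRows.filter fun x => TamX.rowExactX (x.2.1.map TamC.toLocal) x.2.2).length = 6558 ∧
    (rank3TamRows.filter fun x => !TamX.rowExactX (x.2.1.map TamC.toLocal) x.2.2).length = 2929 := by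
  refine ⟨?_, ?_⟩ <;> decide +kernel

set_option maxHeartbeats 2000000 in
/-- LOCAL exactness: of the `31050` certified local Tamagawa numbers, `27856` are now kernel-exact singletons
(stage 1: `26433`); the `3194` remaining brackets are the `435` primes of type `I₀*` and the `2759` of type `Iₙ*`.
[cite: Silverman1994, IV.9.4] -/
theorem rank3TamRows_local_exact_count :
    (rank3TamRows.map fun x => x.2.1.length).sum = 31050 ∧
    ((rank3TamRows.flatMap fun x => (x.2.1.map TamC.toLocal).map fun E => (TamX.valsX x.2.2 E).length).count 1)
      = 27856 := by
  refine ⟨?_, ?_⟩ <;> decide +kernel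

set_option maxHeartbeats 20000000 in
/-- Every sharpened set has at most `12` elements (pointwise no larger than the stage-1 set). [cite: Silverman1994, IV.9.4] -/
theorem rank3TamRows_rowValsX_length_le :
    (rank3TamRows.all fun x => decide ((TamX.rowValsX (x.2.1.map TamC.toLocal) x.2.2).length ≤ 12))
      = true := by
  decide +kernel

set_option maxHeartbeats 2000000 in
/-- `∏_v c_v = 1` is kernel-certified for exactly `458` rows (unchanged: the sharpened primes mostly have
`c_p = 3`); the largest certified exact product is `480`. [cite: CremonaAlgorithms1997, Table 1] -/
theorem rank3TamRows_exact_one_count :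
    (rank3TamRows.filter fun x => TamX.rowExactX (x.2.1.map TamC.toLocal) x.2.2 &&
      decide (TamX.rowValueX (x.2.1.map TamC.toLocal) x.2.2 = 1)).length = 458 ∧
    (rank3TamRows.all fun x => !TamX.rowExactX (x.2.1.map TamC.toLocal) x.2.2 ||
      decide (TamX.rowValueX (x.2.1.map TamC.toLocal) x.2.2 ≤ 480)) = true := by
  refine ⟨?_, ?_⟩ <;> decide +kernel

end Summit.BirchSwinnertonDyer.BirchSwinnertonDyer.Rank2Observatory.Tam
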